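import Mathlib.Topology.MetricSpace.GromovHausdorff
import Literature.Geometry.MetricGeometry.Submetry
import HarnessLib

/-!
# Gromov–Hausdorff approximations, equivariant Gromov–Hausdorff approximations, orbit spaces

The working vocabulary of (equivariant) Gromov–Hausdorff convergence as it is used in
collapsing theory — Fukaya 1986, Fukaya–Yamaguchi 1992, and Huang–Huang–Wang–Zhu 2026, §2.1 p. 6
(whose Main Theorem 1 is vendored in `Literature/Geometry/Riemannian/AlmostNonnegRicciFibration.lean`
and whose printed proof, §4 pp. 13–14, runs entirely on equivariant Gromov–Hausdorff approximations
`(M̂ᵢ, p̂ᵢ, Hᵢ) → (ℝˢ × Ŷ, ·, H)` and the induced approximations of orbit spaces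
`Mᵢ = M̂ᵢ/Hᵢ → X`, `B_{Rᵢ}(p̂ᵢ)/K̂ᵢ → X̄ = (ℝˢ × Ŷ)/H₀`). Mathlib has the Gromov–Hausdorff *distance*
of nonempty compact metric spaces (`GromovHausdorff.ghDist`, realised by an optimal coupling) and
Gromov's precompactness criterion (`GromovHausdorff.totallyBounded`), but no notion of an
`ε`-approximation *map*, which is what every argument in the source manipulates. This file supplies:

§1. `IsGHApprox ε f`: `f : X → Y` has distortion `|d(f x₁, f x₂) - d(x₁, x₂)| ≤ ε` and `ε`-dense
image. API: the identity / a surjective isometry is a `0`-approximation, monotonicity in `ε`,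
composition (`ε + 2δ`), and the quasi-inverse (`3ε`) of an approximation.

§2. BRIDGE TO MATHLIB, both directions, for nonempty compact metric spaces: an `ε`-approximation
gives `ghDist X Y ≤ 3ε/2` (`IsGHApprox.ghDist_le`), and `ghDist X Y < ε` gives a `2ε`-approximation
(`exists_isGHApprox_of_ghDist_lt`, through Mathlib's optimal coupling `optimalGHInjl/optimalGHInjr`).
Hence "`Xᵢ → X` in the Gromov–Hausdorff sense" may be read either way, as the source does tacitly.

§3. GROMOV'S PRECOMPACTNESS THEOREM in the sequential form in which it is quoted
(Huang–Huang–Wang–Zhu 2026, Thm 2.1, first assertion, absolute case): a sequence of compact metric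
spaces with uniformly bounded diameters and uniformly bounded covering numbers has a subsequence
converging in `GHSpace` (`exists_tendsto_subseq_of_coverings`, from Mathlib's `totallyBounded` and the
completeness of `GHSpace`).

§4. EQUIVARIANT APPROXIMATIONS (Fukaya–Yamaguchi; Huang–Huang–Wang–Zhu 2026, §2.1 p. 6, in the
absolute = unpointed form adequate for compact spaces): `IsEquivGHApprox ε f φ ψ` for isometric
actions `G ↷ X`, `H ↷ Y`, a map `f : X → Y` and maps `φ : G → H`, `ψ : H → G` (no homomorphism
required, as in the source) with `f` an `ε`-approximation, `d(φ(g) • f x, f (g • x)) ≤ ε` and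
`d(k • f x, f (ψ(k) • x)) ≤ ε`.

§5. ORBIT SPACES (the "Moreover" of Huang–Huang–Wang–Zhu 2026, Thm 2.1 = Fukaya–Yamaguchi 1992,
Prop. 3.6, made quantitative): an `ε`-equivariant approximation distorts the orbit pseudodistances
(`Literature.Geometry.MetricGeometry.instPseudoMetricSpaceOrbitRelQuotient`) by at most `2ε` in each
direction (`dist_mk_map_mk_map_le`, `dist_mk_mk_le_dist_mk_map_mk_map_add`), and the induced map of orbit spaces
`X/G → Y/H` is a `3ε`-approximation (`IsEquivGHApprox.isGHApprox_orbitMap`). Consequently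
equivariant convergence `(Xᵢ, Gᵢ) → (X, G)` forces `Xᵢ/Gᵢ → X/G`.

Everything here is a definition with body or a proved theorem; no named facts.

## References

* K. Fukaya, *Theory of convergence for Riemannian orbifolds*, Japan. J. Math. 12 (1986) 121–160.
* K. Fukaya, T. Yamaguchi, *The fundamental groups of almost nonnegatively curved manifolds*,
  Ann. of Math. 136 (1992) 253–333, §3 (equivariant Hausdorff convergence, Prop. 3.6).
* M. Gromov, *Groups of polynomial growth and expanding maps*, Publ. IHÉS 53 (1981), precompactness.
* H. Huang, X.-T. Huang, J. Wang, X. Zhu, arXiv:2605.24380 (2026), §2.1 p. 6, Thm 2.1; §4 pp. 13–14.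
  [HuangHuangWangZhu2026]
-/

noncomputable section

open Metric Set Filter
open scoped Topology Cardinal

namespace Literature.Geometry.MetricGeometry

/-! ### §1. Gromov–Hausdorff approximations -/

section GHApprox

variable {X Y Z : Type*} [PseudoMetricSpace X] [PseudoMetricSpace Y] [PseudoMetricSpace Z]

/-- A map `f : X → Y` between (pseudo)metric spaces is an **`ε`-Gromov–Hausdorff approximation**
(`ε`-GHA) if it has distortion at most `ε`, `|d(f x₁, f x₂) - d(x₁, x₂)| ≤ ε` for all `x₁ x₂`, and
`ε`-dense image, `∀ y, ∃ x, d(f x, y) ≤ ε`. (Absolute form; the source's pointed `ε`-approximations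
`B_{1/ε}(p) → B_{1/ε+ε}(q)` restrict this to balls. Conventions in the literature differ by factors
of `2` in the density constant; we take the same constant for both clauses.)
[cite: HuangHuangWangZhu2026, §2.1 p. 6 (first bullet of the definition of an ε-eGHA)] -/
def IsGHApprox (ε : ℝ) (f : X → Y) : Prop :=
  (∀ x₁ x₂ : X, |dist (f x₁) (f x₂) - dist x₁ x₂| ≤ ε) ∧ ∀ y : Y, ∃ x : X, dist (f x) y ≤ ε

variable {ε δ : ℝ} {f : X → Y} {g : Y → Z}

/-- Unfolding lemma for `IsGHApprox`. [folklore] -/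
theorem isGHApprox_iff : IsGHApprox ε f ↔
    (∀ x₁ x₂ : X, |dist (f x₁) (f x₂) - dist x₁ x₂| ≤ ε) ∧ ∀ y : Y, ∃ x : X, dist (f x) y ≤ ε :=
  Iff.rfl

/-- The distortion bound of a GH approximation. [folklore] -/
theorem IsGHApprox.abs_sub_le (hf : IsGHApprox ε f) (x₁ x₂ : X) :
    |dist (f x₁) (f x₂) - dist x₁ x₂| ≤ ε :=
  hf.1 x₁ x₂

/-- A GH approximation increases distances by at most `ε`. [folklore] -/
theorem IsGHApprox.dist_le (hf : IsGHApprox ε f) (x₁ x₂ : X) :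
    dist (f x₁) (f x₂) ≤ dist x₁ x₂ + ε := by
  have h := (abs_le.mp (hf.1 x₁ x₂)).2
  linarith

/-- A GH approximation decreases distances by at most `ε`. [folklore] -/
theorem IsGHApprox.le_dist_add (hf : IsGHApprox ε f) (x₁ x₂ : X) :
    dist x₁ x₂ ≤ dist (f x₁) (f x₂) + ε := by
  have h := (abs_le.mp (hf.1 x₁ x₂)).1
  linarith

/-- The density clause of a GH approximation. [folklore] -/
theorem IsGHApprox.exists_dist_le (hf : IsGHApprox ε f) (y : Y) : ∃ x : X, dist (f x) y ≤ ε :=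
  hf.2 y

/-- The constant of a GH approximation with nonempty source is nonnegative. [folklore] -/
theorem IsGHApprox.nonneg (hf : IsGHApprox ε f) (x : X) : 0 ≤ ε := by
  have h := hf.1 x x
  simp only [dist_self, sub_self, abs_zero] at h
  exact h

/-- The constant of a GH approximation with nonempty target is nonnegative. [folklore] -/
theorem IsGHApprox.nonneg' (hf : IsGHApprox ε f) (y : Y) : 0 ≤ ε := by
  obtain ⟨x, -⟩ := hf.2 y
  exact hf.nonneg x

/-- Monotonicity in the constant. [folklore] -/
theorem IsGHApprox.mono (hf : IsGHApprox ε f) (h : ε ≤ δ) : IsGHApprox δ f :=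
  ⟨fun x₁ x₂ ↦ (hf.1 x₁ x₂).trans h, fun y ↦ (hf.2 y).imp fun _ hx ↦ hx.trans h⟩

/-- A surjective map preserving distances is an `ε`-GH approximation for every `ε ≥ 0`.
[folklore] -/
theorem isGHApprox_of_dist_eq_of_surjective (hdist : ∀ x₁ x₂ : X, dist (f x₁) (f x₂) = dist x₁ x₂)
    (hsurj : Function.Surjective f) (hε : 0 ≤ ε) : IsGHApprox ε f := by
  refine ⟨fun x₁ x₂ ↦ by simpa [hdist x₁ x₂] using hε, fun y ↦ ?_⟩
  obtain ⟨x, rfl⟩ := hsurj y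
  exact ⟨x, by simpa using hε⟩

/-- A surjective isometry is an `ε`-GH approximation for every `ε ≥ 0`. [folklore] -/
theorem _root_.Isometry.isGHApprox (hf : Isometry f) (hsurj : Function.Surjective f) (hε : 0 ≤ ε) :
    IsGHApprox ε f :=
  isGHApprox_of_dist_eq_of_surjective (fun x₁ x₂ ↦ hf.dist_eq x₁ x₂) hsurj hε

/-- An isometric equivalence is an `ε`-GH approximation for every `ε ≥ 0`. [folklore] -/
theorem _root_.IsometryEquiv.isGHApprox (e : X ≃ᵢ Y) (hε : 0 ≤ ε) : IsGHApprox ε (e : X → Y) :=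
  e.isometry.isGHApprox e.surjective hε

/-- The identity is an `ε`-GH approximation for every `ε ≥ 0`. [folklore] -/
theorem isGHApprox_id (hε : 0 ≤ ε) : IsGHApprox ε (id : X → X) :=
  isGHApprox_of_dist_eq_of_surjective (fun _ _ ↦ rfl) Function.surjective_id hε

/-- Composition: a `δ`-approximation after an `ε`-approximation is an `(ε + 2δ)`-approximation
(distortion `ε + δ`, density `ε + 2δ`). [folklore] -/
theorem IsGHApprox.comp (hg : IsGHApprox δ g) (hf : IsGHApprox ε f) :
    IsGHApprox (ε + 2 * δ) (g ∘ f) := by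
  refine ⟨fun x₁ x₂ ↦ ?_, fun z ↦ ?_⟩
  · have hδ : 0 ≤ δ := hg.nonneg (f x₁)
    have h1 := hg.1 (f x₁) (f x₂)
    have h2 := hf.1 x₁ x₂
    rw [abs_le] at h1 h2 ⊢
    simp only [Function.comp_apply]
    constructor <;> linarith [h1.1, h1.2, h2.1, h2.2]
  · obtain ⟨y, hy⟩ := hg.2 z
    obtain ⟨x, hx⟩ := hf.2 y
    refine ⟨x, ?_⟩
    simp only [Function.comp_apply]
    calc dist (g (f x)) z ≤ dist (g (f x)) (g y) + dist (g y) z := dist_triangle _ _ _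
      _ ≤ (dist (f x) y + δ) + δ := add_le_add (hg.dist_le _ _) hy
      _ ≤ ε + 2 * δ := by linarith

/-- QUASI-INVERSE. An `ε`-GH approximation `f : X → Y` admits a quasi-inverse `g : Y → X`
(send `y` to any `x` with `d(f x, y) ≤ ε`): `g` is a `3ε`-GH approximation, `d(g (f x), x) ≤ 2ε`
and `d(f (g y), y) ≤ ε`. In particular being `ε`-GH-close is symmetric up to a factor `3`.
[folklore] -/
theorem IsGHApprox.exists_quasiInverse (hf : IsGHApprox ε f) :
    ∃ g : Y → X, IsGHApprox (3 * ε) g ∧ (∀ x : X, dist (g (f x)) x ≤ 2 * ε) ∧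
      ∀ y : Y, dist (f (g y)) y ≤ ε := by
  choose g hg using hf.2
  have hgf : ∀ x : X, dist (g (f x)) x ≤ 2 * ε := fun x ↦ by
    have h1 := hf.le_dist_add (g (f x)) x
    have h2 := hg (f x)
    linarith
  refine ⟨g, ⟨fun y₁ y₂ ↦ ?_, fun x ↦ ⟨f x, ?_⟩⟩, hgf, hg⟩
  · have h1 := hf.1 (g y₁) (g y₂)
    have h2 : |dist (f (g y₁)) (f (g y₂)) - dist y₁ y₂| ≤ dist (f (g y₁)) y₁ + dist (f (g y₂)) y₂ := by
      rw [← Real.dist_eq]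
      exact dist_dist_dist_le _ _ _ _
    have h3 := hg y₁
    have h4 := hg y₂
    rw [abs_le] at h1 h2 ⊢
    constructor <;> linarith [h1.1, h1.2, h2.1, h2.2]
  · have hε : 0 ≤ ε := hf.nonneg x
    linarith [hgf x]

end GHApprox

/-! ### §2. Bridge to Mathlib's Gromov–Hausdorff distance -/

section Bridge

variable {X : Type*} [MetricSpace X] [CompactSpace X] [Nonempty X]
  {Y : Type*} [MetricSpace Y] [CompactSpace Y] [Nonempty Y] {ε : ℝ}

/-- An `ε`-GH approximation between nonempty compact metric spaces bounds Mathlib's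
Gromov–Hausdorff distance: `ghDist X Y ≤ 3ε/2` (Mathlib's `ghDist_le_of_approx_subsets` with
`s = univ`, `ε₁ = 0`, `ε₂ = ε₃ = ε`). [folklore] -/
theorem IsGHApprox.ghDist_le {f : X → Y} (hf : IsGHApprox ε f) :
    GromovHausdorff.ghDist X Y ≤ 3 * ε / 2 := by
  have h := GromovHausdorff.ghDist_le_of_approx_subsets (s := (univ : Set X))
    (fun x ↦ f x) (ε₁ := 0) (ε₂ := ε) (ε₃ := ε)
    (fun x ↦ ⟨x, mem_univ x, by simp⟩)
    (fun y ↦ by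
      obtain ⟨x, hx⟩ := hf.2 y
      exact ⟨⟨x, mem_univ x⟩, by rwa [dist_comm]⟩)
    (fun x y ↦ by
      rw [abs_sub_comm]
      exact hf.1 x y)
  linarith

variable (X Y) in
/-- Conversely, if `ghDist X Y < ε` for nonempty compact metric spaces then there is a
`2ε`-GH approximation `X → Y`: realise the distance by Mathlib's optimal coupling
`Φ = optimalGHInjl X Y`, `Ψ = optimalGHInjr X Y` (isometric embeddings into `OptimalGHCoupling X Y`
with `hausdorffDist (range Φ) (range Ψ) = ghDist X Y`) and send `x` to any `y` with
`d(Φ x, Ψ y) < ε`. [folklore] -/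
theorem exists_isGHApprox_of_ghDist_lt (h : GromovHausdorff.ghDist X Y < ε) :
    ∃ f : X → Y, IsGHApprox (2 * ε) f := by
  set Φ := GromovHausdorff.optimalGHInjl X Y with hΦ
  set Ψ := GromovHausdorff.optimalGHInjr X Y with hΨ
  have hΦi : Isometry Φ := GromovHausdorff.isometry_optimalGHInjl X Y
  have hΨi : Isometry Ψ := GromovHausdorff.isometry_optimalGHInjr X Y
  have hH : hausdorffDist (range Φ) (range Ψ) < ε := by
    rw [GromovHausdorff.hausdorffDist_optimal]
    exact h
  have hfin : hausdorffEDist (range Φ) (range Ψ) ≠ ⊤ :=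
    hausdorffEDist_ne_top_of_nonempty_of_bounded (range_nonempty Φ) (range_nonempty Ψ)
      (isCompact_range hΦi.continuous).isBounded (isCompact_range hΨi.continuous).isBounded
  have hx : ∀ x : X, ∃ y : Y, dist (Φ x) (Ψ y) < ε := fun x ↦ by
    obtain ⟨_, ⟨y, rfl⟩, hy⟩ := exists_dist_lt_of_hausdorffDist_lt (mem_range_self x) hH hfin
    exact ⟨y, hy⟩
  choose f hf using hx
  refine ⟨f, fun x₁ x₂ ↦ ?_, fun y ↦ ?_⟩
  · have h1 : |dist (Ψ (f x₁)) (Ψ (f x₂)) - dist (Φ x₁) (Φ x₂)| ≤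
        dist (Ψ (f x₁)) (Φ x₁) + dist (Ψ (f x₂)) (Φ x₂) := by
      rw [← Real.dist_eq]
      exact dist_dist_dist_le _ _ _ _
    rw [hΨi.dist_eq, hΦi.dist_eq] at h1
    have h2 := hf x₁
    have h3 := hf x₂
    rw [dist_comm] at h2 h3
    linarith
  · obtain ⟨_, ⟨x, rfl⟩, hxy⟩ := exists_dist_lt_of_hausdorffDist_lt' (mem_range_self y) hH hfin
    refine ⟨x, ?_⟩
    calc dist (f x) y = dist (Ψ (f x)) (Ψ y) := (hΨi.dist_eq _ _).symm
      _ ≤ dist (Ψ (f x)) (Φ x) + dist (Φ x) (Ψ y) := dist_triangle _ _ _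
      _ ≤ 2 * ε := by
        have h2 := hf x
        rw [dist_comm] at h2
        linarith

end Bridge

/-! ### §3. Gromov's precompactness theorem, sequential form -/

section Precompactness

open GromovHausdorff

/-- In a complete space a sequence in a totally bounded set has a convergent subsequence (with
limit in the closure). [folklore] -/
theorem exists_tendsto_subseq_of_totallyBounded {E : Type*} [MetricSpace E] [CompleteSpace E]
    {t : Set E} (ht : TotallyBounded t) (u : ℕ → E) (hu : ∀ n, u n ∈ t) :
    ∃ p ∈ closure t, ∃ φ : ℕ → ℕ, StrictMono φ ∧ Tendsto (u ∘ φ) atTop (𝓝 p) := by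
  have hK : IsCompact (closure t) :=
    isCompact_iff_totallyBounded_isComplete.mpr ⟨ht.closure, isClosed_closure.isComplete⟩
  exact hK.tendsto_subseq fun n ↦ subset_closure (hu n)

/-- GROMOV'S PRECOMPACTNESS THEOREM, sequential form (the first assertion of
Huang–Huang–Wang–Zhu 2026, Thm 2.1, in the absolute case): a sequence of nonempty compact metric
spaces `pᵢ ∈ GHSpace` with diameters `≤ C` and, for each `n`, at most `K n` balls of radius `u n`
covering each `pᵢ` (`u n → 0`), has a subsequence converging in the Gromov–Hausdorff space. From
Mathlib's `GromovHausdorff.totallyBounded` and the completeness of `GHSpace`.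
[cite: HuangHuangWangZhu2026, Thm 2.1 (Gromov; Fukaya–Yamaguchi 1992)] -/
theorem exists_tendsto_subseq_of_coverings {C : ℝ} {u : ℕ → ℝ} {K : ℕ → ℕ}
    (ulim : Tendsto u atTop (𝓝 0)) (p : ℕ → GHSpace)
    (hdiam : ∀ i, diam (univ : Set (GHSpace.Rep (p i))) ≤ C)
    (hcov : ∀ i n, ∃ s : Set (GHSpace.Rep (p i)), #s ≤ K n ∧ univ ⊆ ⋃ x ∈ s, ball x (u n)) :
    ∃ q : GHSpace, ∃ φ : ℕ → ℕ, StrictMono φ ∧ Tendsto (p ∘ φ) atTop (𝓝 q) := by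
  have ht : TotallyBounded (range p) := by
    refine GromovHausdorff.totallyBounded (t := range p) (C := C) (u := u) (K := K) ulim ?_ ?_
    · rintro _ ⟨i, rfl⟩
      exact hdiam i
    · rintro _ ⟨i, rfl⟩ n
      exact hcov i n
  obtain ⟨q, -, φ, hφ, hlim⟩ := exists_tendsto_subseq_of_totallyBounded ht p mem_range_self
  exact ⟨q, φ, hφ, hlim⟩

end Precompactness

/-! ### §4. Equivariant Gromov–Hausdorff approximations -/

section Equivariant

variable {G H X Y : Type*} [Group G] [Group H] [PseudoMetricSpace X] [PseudoMetricSpace Y]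
  [MulAction G X] [MulAction H Y]

/-- An **`ε`-equivariant Gromov–Hausdorff approximation** (`ε`-eGHA) from the isometric action
`G ↷ X` to the isometric action `H ↷ Y` is a triple `(f, φ, ψ)` of maps `f : X → Y`, `φ : G → H`,
`ψ : H → G` (no algebraic condition on `φ`, `ψ`) such that `f` is an `ε`-GH approximation,
`d(φ(g) • f x, f (g • x)) ≤ ε` for all `g, x`, and `d(k • f x, f (ψ(k) • x)) ≤ ε` for all `k, x`.
This is the definition of Fukaya–Yamaguchi as printed in Huang–Huang–Wang–Zhu 2026, §2.1 p. 6, in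
ABSOLUTE form: the source works with pointed spaces and restricts `x` to `B_{1/ε}(p)` and `g`, `k`
to `G(1/ε) = {g | d(g p, p) < 1/ε}`, `H(1/ε)`; for spaces of diameter `< 1/ε` (the compact case of
§4 of the source) the two agree up to the harmless replacement of `<` by `≤`.
[cite: HuangHuangWangZhu2026, §2.1 p. 6 (definition of an ε-eGHA)] -/
def IsEquivGHApprox (ε : ℝ) (f : X → Y) (φ : G → H) (ψ : H → G) : Prop :=
  IsGHApprox ε f ∧ (∀ (g : G) (x : X), dist (φ g • f x) (f (g • x)) ≤ ε) ∧
    ∀ (k : H) (x : X), dist (k • f x) (f (ψ k • x)) ≤ ε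

variable {ε : ℝ} {f : X → Y} {φ : G → H} {ψ : H → G}

/-- Unfolding lemma for `IsEquivGHApprox`. [folklore] -/
theorem isEquivGHApprox_iff : IsEquivGHApprox ε f φ ψ ↔
    IsGHApprox ε f ∧ (∀ (g : G) (x : X), dist (φ g • f x) (f (g • x)) ≤ ε) ∧
      ∀ (k : H) (x : X), dist (k • f x) (f (ψ k • x)) ≤ ε :=
  Iff.rfl

/-- The underlying GH approximation. [folklore] -/
theorem IsEquivGHApprox.isGHApprox (h : IsEquivGHApprox ε f φ ψ) : IsGHApprox ε f :=
  h.1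

/-- Almost-equivariance along `φ`. [folklore] -/
theorem IsEquivGHApprox.dist_smul_map_le (h : IsEquivGHApprox ε f φ ψ) (g : G) (x : X) :
    dist (φ g • f x) (f (g • x)) ≤ ε :=
  h.2.1 g x

/-- Almost-equivariance along `ψ`. [folklore] -/
theorem IsEquivGHApprox.dist_smul_map_le' (h : IsEquivGHApprox ε f φ ψ) (k : H) (x : X) :
    dist (k • f x) (f (ψ k • x)) ≤ ε :=
  h.2.2 k x

/-- Monotonicity in the constant. [folklore] -/
theorem IsEquivGHApprox.mono {δ : ℝ} (h : IsEquivGHApprox ε f φ ψ) (hle : ε ≤ δ) :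
    IsEquivGHApprox δ f φ ψ :=
  ⟨h.1.mono hle, fun g x ↦ (h.2.1 g x).trans hle, fun k x ↦ (h.2.2 k x).trans hle⟩

/-- An equivariant surjective distance-preserving map (along a map `φ : G → H` with a right
inverse `ψ` on the level of the actions) is an `ε`-eGHA for every `ε ≥ 0`; in particular an
equivariant isometric equivalence is a `0`-eGHA. Non-vacuity witness. [folklore] -/
theorem isEquivGHApprox_of_equivariant (hdist : ∀ x₁ x₂ : X, dist (f x₁) (f x₂) = dist x₁ x₂)
    (hsurj : Function.Surjective f) (hφ : ∀ (g : G) (x : X), f (g • x) = φ g • f x)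
    (hψ : ∀ (k : H) (x : X), f (ψ k • x) = k • f x) (hε : 0 ≤ ε) : IsEquivGHApprox ε f φ ψ :=
  ⟨isGHApprox_of_dist_eq_of_surjective hdist hsurj hε, fun g x ↦ by simpa [hφ g x] using hε,
    fun k x ↦ by simpa [hψ k x] using hε⟩

/-- The identity triple is a `0`-eGHA of any isometric action to itself. [folklore] -/
theorem isEquivGHApprox_id (hε : 0 ≤ ε) :
    IsEquivGHApprox ε (id : X → X) (id : G → G) (id : G → G) :=
  isEquivGHApprox_of_equivariant (fun _ _ ↦ rfl) Function.surjective_id (fun _ _ ↦ rfl)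
    (fun _ _ ↦ rfl) hε

end Equivariant

/-! ### §5. Equivariant approximations induce approximations of orbit spaces -/

section OrbitMap

variable (G H : Type*) {X Y : Type*} [Group G] [Group H] [MulAction G X] [MulAction H Y]

/-- The map of orbit spaces `X/G → Y/H` induced by an arbitrary map `f : X → Y` through chosen
representatives: `⟦x⟧ ↦ ⟦f (⟦x⟧.out)⟧`. (When `f` is equivariant along a map `G → H` this is the
usual induced map; for an almost-equivariant `f` it is well defined up to `2ε`, which is all that
Gromov–Hausdorff approximations see.) [folklore] -/
def orbitMap (f : X → Y) : MulAction.orbitRel.Quotient G X → MulAction.orbitRel.Quotient H Y :=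
  fun q ↦ ⟦f q.out⟧

/-- Unfolding lemma for `orbitMap`. [folklore] -/
theorem orbitMap_apply (f : X → Y) (q : MulAction.orbitRel.Quotient G X) :
    orbitMap G H f q = ⟦f q.out⟧ :=
  rfl

/-- For an `f` equivariant along any map `φ : G → H`, `orbitMap` is the usual induced map:
`orbitMap G H f ⟦x⟧ = ⟦f x⟧`. [folklore] -/
theorem orbitMap_mk_of_equivariant {f : X → Y} {φ : G → H}
    (hf : ∀ (g : G) (x : X), f (g • x) = φ g • f x) (x : X) :
    orbitMap G H f ⟦x⟧ = (⟦f x⟧ : MulAction.orbitRel.Quotient H Y) := by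
  rw [orbitMap_apply]
  apply Quotient.sound
  obtain ⟨g, hg⟩ := MulAction.orbitRel_apply.mp
    (Quotient.exact (s := MulAction.orbitRel G X) ((⟦x⟧ : MulAction.orbitRel.Quotient G X).out_eq))
  refine MulAction.orbitRel_apply.mpr ⟨φ g, ?_⟩
  simp only at hg ⊢
  rw [← hf, hg]

end OrbitMap

section OrbitSpaces

variable {G H X Y : Type*} [Group G] [Group H] [PseudoMetricSpace X] [PseudoMetricSpace Y]
  [MulAction G X] [MulAction H Y] [IsIsometricSMul G X] [IsIsometricSMul H Y]
  {ε : ℝ} {f : X → Y} {φ : G → H} {ψ : H → G}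

/-- An `ε`-eGHA increases orbit distances by at most `2ε`:
`d_{Y/H}(⟦f x₁⟧, ⟦f x₂⟧) ≤ d_{X/G}(⟦x₁⟧, ⟦x₂⟧) + 2ε`. Proof: if `d(x₁, g • x₂)` almost realises the
orbit distance then `d(f x₁, φ(g) • f x₂) ≤ d(f x₁, f(g • x₂)) + ε ≤ d(x₁, g • x₂) + 2ε`.
[cite: HuangHuangWangZhu2026, Thm 2.1 ("Moreover"; Fukaya–Yamaguchi 1992, Prop. 3.6)] -/
theorem IsEquivGHApprox.dist_mk_map_mk_map_le (h : IsEquivGHApprox ε f φ ψ) (x₁ x₂ : X) :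
    dist (⟦f x₁⟧ : MulAction.orbitRel.Quotient H Y) ⟦f x₂⟧ ≤
      dist (⟦x₁⟧ : MulAction.orbitRel.Quotient G X) ⟦x₂⟧ + 2 * ε := by
  refine le_of_forall_pos_lt_add fun η hη ↦ ?_
  obtain ⟨g, hg⟩ := exists_dist_smul_lt_of_dist_mk_mk_lt (G := G) (x := x₁) (y := x₂)
    (lt_add_of_pos_right _ hη)
  calc dist (⟦f x₁⟧ : MulAction.orbitRel.Quotient H Y) ⟦f x₂⟧
      ≤ dist (f x₁) (φ g • f x₂) := dist_mk_mk_le_dist_smul _ _ _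
    _ ≤ dist (f x₁) (f (g • x₂)) + dist (f (g • x₂)) (φ g • f x₂) := dist_triangle _ _ _
    _ ≤ (dist x₁ (g • x₂) + ε) + ε := by
        refine add_le_add (h.1.dist_le _ _) ?_
        rw [dist_comm]
        exact h.2.1 g x₂
    _ < dist (⟦x₁⟧ : MulAction.orbitRel.Quotient G X) ⟦x₂⟧ + 2 * ε + η := by linarith

/-- An `ε`-eGHA decreases orbit distances by at most `2ε`:
`d_{X/G}(⟦x₁⟧, ⟦x₂⟧) ≤ d_{Y/H}(⟦f x₁⟧, ⟦f x₂⟧) + 2ε`. Proof: if `d(f x₁, k • f x₂)` almost realises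
the orbit distance then `d(x₁, ψ(k) • x₂) ≤ d(f x₁, f(ψ(k) • x₂)) + ε ≤ d(f x₁, k • f x₂) + 2ε`.
[cite: HuangHuangWangZhu2026, Thm 2.1 ("Moreover"; Fukaya–Yamaguchi 1992, Prop. 3.6)] -/
theorem IsEquivGHApprox.dist_mk_mk_le_dist_mk_map_mk_map_add (h : IsEquivGHApprox ε f φ ψ)
    (x₁ x₂ : X) :
    dist (⟦x₁⟧ : MulAction.orbitRel.Quotient G X) ⟦x₂⟧ ≤
      dist (⟦f x₁⟧ : MulAction.orbitRel.Quotient H Y) ⟦f x₂⟧ + 2 * ε := by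
  refine le_of_forall_pos_lt_add fun η hη ↦ ?_
  obtain ⟨k, hk⟩ := exists_dist_smul_lt_of_dist_mk_mk_lt (G := H) (x := f x₁) (y := f x₂)
    (lt_add_of_pos_right _ hη)
  calc dist (⟦x₁⟧ : MulAction.orbitRel.Quotient G X) ⟦x₂⟧
      ≤ dist x₁ (ψ k • x₂) := dist_mk_mk_le_dist_smul _ _ _
    _ ≤ dist (f x₁) (f (ψ k • x₂)) + ε := h.1.le_dist_add _ _
    _ ≤ (dist (f x₁) (k • f x₂) + dist (k • f x₂) (f (ψ k • x₂))) + ε := by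
        linarith [dist_triangle (f x₁) (k • f x₂) (f (ψ k • x₂))]
    _ ≤ (dist (f x₁) (k • f x₂) + ε) + ε := by
        gcongr
        exact h.2.2 k x₂
    _ < dist (⟦f x₁⟧ : MulAction.orbitRel.Quotient H Y) ⟦f x₂⟧ + 2 * ε + η := by linarith

/-- The orbit-distance distortion of an `ε`-eGHA is at most `2ε`. [folklore] -/
theorem IsEquivGHApprox.abs_dist_mk_map_sub_le (h : IsEquivGHApprox ε f φ ψ) (x₁ x₂ : X) :
    |dist (⟦f x₁⟧ : MulAction.orbitRel.Quotient H Y) ⟦f x₂⟧ -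
        dist (⟦x₁⟧ : MulAction.orbitRel.Quotient G X) ⟦x₂⟧| ≤ 2 * ε := by
  rw [abs_le]
  constructor
  · linarith [h.dist_mk_mk_le_dist_mk_map_mk_map_add x₁ x₂]
  · linarith [h.dist_mk_map_mk_map_le x₁ x₂]

/-- On an orbit `⟦x⟧` the induced map is `2ε`-close to `⟦f x⟧`. [folklore] -/
theorem IsEquivGHApprox.dist_orbitMap_mk_le (h : IsEquivGHApprox ε f φ ψ) (x : X) :
    dist (orbitMap G H f ⟦x⟧) (⟦f x⟧ : MulAction.orbitRel.Quotient H Y) ≤ 2 * ε := by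
  rw [orbitMap_apply]
  have h1 := h.dist_mk_map_mk_map_le ((⟦x⟧ : MulAction.orbitRel.Quotient G X).out) x
  rwa [Quotient.out_eq, dist_self, zero_add] at h1

/-- ORBIT SPACES OF EQUIVARIANTLY CLOSE ACTIONS ARE CLOSE (Fukaya–Yamaguchi; the "Moreover" of
Huang–Huang–Wang–Zhu 2026, Thm 2.1, quantitatively): if `(f, φ, ψ)` is an `ε`-eGHA from `G ↷ X` to
`H ↷ Y` then the induced map of orbit spaces `X/G → Y/H` is a `3ε`-GH approximation for the orbit
pseudometrics (distortion `2ε`, density `3ε`). Hence `(Xᵢ, Gᵢ) → (X, G)` equivariantly implies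
`Xᵢ/Gᵢ → X/G`.
[cite: HuangHuangWangZhu2026, Thm 2.1 ("Moreover"; Fukaya–Yamaguchi 1992, Prop. 3.6)] -/
theorem IsEquivGHApprox.isGHApprox_orbitMap (h : IsEquivGHApprox ε f φ ψ) :
    IsGHApprox (3 * ε) (orbitMap G H f) := by
  refine ⟨fun q₁ q₂ ↦ ?_, fun q ↦ ?_⟩
  · have hε : 0 ≤ ε := h.1.nonneg q₁.out
    have h1 := h.abs_dist_mk_map_sub_le q₁.out q₂.out
    simp only [Quotient.out_eq] at h1
    rw [orbitMap_apply, orbitMap_apply]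
    exact h1.trans (by linarith)
  · induction q using Quotient.inductionOn with
    | h y =>
      obtain ⟨x, hx⟩ := h.1.2 y
      refine ⟨⟦x⟧, ?_⟩
      calc dist (orbitMap G H f ⟦x⟧) (⟦y⟧ : MulAction.orbitRel.Quotient H Y)
          ≤ dist (orbitMap G H f ⟦x⟧) (⟦f x⟧ : MulAction.orbitRel.Quotient H Y) +
              dist (⟦f x⟧ : MulAction.orbitRel.Quotient H Y) ⟦y⟧ := dist_triangle _ _ _
        _ ≤ 2 * ε + dist (f x) y := add_le_add (h.dist_orbitMap_mk_le x) (dist_mk_mk_le _ _)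
        _ ≤ 3 * ε := by linarith

end OrbitSpaces

end Literature.Geometry.MetricGeometry

end
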